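import Summits.CriticalPhenomena.PercolationContinuityZ3.Theorems.PercNearOneGluingNoHeavyQuantDepthTwoRelayCap
import HarnessLib

/-!
# QUANT lane R8, SGC in the RELAY case: the top-atom form of the relay capacity inequality — inequality (B) of census-2 g67 at the layer
# endpoint WITHOUT the non-cheap hypothesis (the cheap branch pays with the unshifted copy alone)

builds on p205010 (kernel theorem, internal audit signed; external expert review pending)

Support file (`--supports stmt-CriticalPhenomena-4575`), QUANT lane seat prim-quant-arm-2 (gen 39), rung R8 of
`run/shared/lean/prim/quant/LADDER.md`; memo `run/shared/lean/prim/quant/prim-quant-arm-2-g39/ONE-ROW-PRINCIPLE-G39.md` §3b (TopL2).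
Theorems only, standard axioms, no sorries; imports `…QuantDepthTwoRelayCap` (census-2 g67).

WHAT.  In the ONE-ROW PRINCIPLE (every product dual row of the relay product is dominated by one factor dual row, this seat) the top atom `a = j`
of the factor layer `j* = j` sees the product GIANT `j + 1` above it, whose charge is at least `(max α′)/u`, `u = y/(1−y)`; when the layer rule has
put `j* = j` the charge `β′(j)` is moreover SMALLER than that giant charge.  For a factor low `l` whose successor is not a product low the needed
per-pair inequality is (`s = T − 2l`, `n = j − l > s`, `σ = s + g`, `θ₀ = min(1−g, s/σ)`, `ψ = 1/pairGate − 1`, `Q = ψ⁺(σ/n)` = the product capacity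
of `(l, j)` at `T + g`):

  **(TopL2)**  `θ₀ · ψ⁺(s/n) ≤ (1−g)·Q + g·max(Q, (1−y)/y)`.

When the pair `(l, j)` is NOT cheap at `T + g` (`y ≤ σ/n`) this is census-2 g67's endpoint inequality `relay_cap_pairGate_top` (✓ p382223) since
`max(Q, (1−y)/y) ≥ (1−y)/y`; when it IS cheap (`σ/n ≤ y`, both minimal gates light) the unshifted copy alone pays: `(s/σ)·ψ(s/n) ≤ ψ(σ/n)`
(`relay_cap_cheap_core`: with `m = yn ≥ σ` the margin is `g[(1+y)m(m−σ) + m(σ − ys) − (1−y)sσ]/(…) ≥ g·σg/(…) ≥ 0`).  Stated for real parameters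
(`relay_cap_top_core`) and for `LawDec.pairGate` (`relay_cap_top_pairGate`).  Exact scan `code/ineq_top.py` (9 020 rational points, worst margin 0 at
the linear boundary).  HONEST STATUS: one real inequality; SGC, D2, G₁ (general), `Quant.FarTreeRow` (light) remain OPEN; nothing here is cited as
a published result; the lane's RATE class log\* and honest sentence (`run/shared/lean/prim/quant/README.md`) are unchanged.

[this work]; inequality (B) and its endpoint form: prim-quant-census-2 g67; minimal gates: prim-quant-stmt g22 (this lane).  The gluing rows served
[cite: KozmaNitzan2024, Conjecture 3 (p. 15)]; product measure [cite: Grimmett1999, §1.3 p. 10].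
-/

noncomputable section

namespace Summit.CriticalPhenomena.PercolationContinuityZ3.Theorems

namespace Quant

namespace LawDec

/-- **the cheap branch**: `0 < y < 1`, `0 ≤ g`, `0 < s < n`, `(s+g)/n ≤ y` (both minimal gates light) ⟹
`(s/(s+g)) · (1/max(s/n, y²+(1−y)s/n) − 1) ≤ 1/max((s+g)/n, y²+(1−y)(s+g)/n) − 1`. [this work] -/
theorem relay_cap_cheap_core (y g s n : ℝ) (hy0 : 0 < y) (hy1 : y < 1) (hg0 : 0 ≤ g) (hs : 0 < s) (hsn : s < n)
    (hcheap : (s + g) / n ≤ y) :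
    s / (s + g) * (1 / max (s / n) (y ^ 2 + (1 - y) * (s / n)) - 1)
      ≤ 1 / max ((s + g) / n) (y ^ 2 + (1 - y) * ((s + g) / n)) - 1 := by
  have hn : 0 < n := lt_trans hs hsn
  have hσ : 0 < s + g := by linarith
  have h1y : 0 < 1 - y := by linarith
  have hm : s + g ≤ y * n := by rwa [div_le_iff₀ hn] at hcheap
  have hρ0 : s / n ≤ y := le_trans (div_le_div_of_nonneg_right (by linarith) hn.le) hcheap
  -- both gates light
  have e0 : max (s / n) (y ^ 2 + (1 - y) * (s / n)) = y ^ 2 + (1 - y) * (s / n) :=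
    max_eq_right (by nlinarith [mul_nonneg hy0.le (sub_nonneg.2 hρ0)])
  have e1 : max ((s + g) / n) (y ^ 2 + (1 - y) * ((s + g) / n)) = y ^ 2 + (1 - y) * ((s + g) / n) :=
    max_eq_right (by nlinarith [mul_nonneg hy0.le (sub_nonneg.2 hcheap)])
  rw [e0, e1]
  have d0 : y ^ 2 + (1 - y) * (s / n) = (y ^ 2 * n + (1 - y) * s) / n := by field_simp
  have d1 : y ^ 2 + (1 - y) * ((s + g) / n) = (y ^ 2 * n + (1 - y) * (s + g)) / n := by field_simp
  have hD0 : 0 < y ^ 2 * n + (1 - y) * s := by positivity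
  have hD1 : 0 < y ^ 2 * n + (1 - y) * (s + g) := by positivity
  rw [d0, d1, one_div_div, one_div_div, div_sub_one hD0.ne', div_sub_one hD1.ne', ← mul_div_assoc,
    div_mul_eq_mul_div, div_div, div_le_div_iff₀ (mul_pos hσ hD0) hD1]
  -- `s(n − D₀)·D₁ ≤ (σ)(n − D₁)·D₀`, margin `g·[(1+y)(yn)(yn−σ) + yn(σ − ys) − (1−y)sσ] ≥ g·σ·g`
  have key : (n - (y ^ 2 * n + (1 - y) * (s + g))) * ((s + g) * (y ^ 2 * n + (1 - y) * s))
      - s * (n - (y ^ 2 * n + (1 - y) * s)) * (y ^ 2 * n + (1 - y) * (s + g))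
      = (1 - y) * g * ((1 + y) * (y * n) * (y * n - (s + g)) + (y * n) * ((s + g) - y * s) - (1 - y) * s * (s + g)) := by ring
  have t1 : 0 ≤ (1 + y) * (y * n) * (y * n - (s + g)) :=
    mul_nonneg (mul_nonneg (by linarith) (mul_nonneg hy0.le hn.le)) (by linarith)
  have t2 : (s + g) * ((s + g) - y * s) ≤ (y * n) * ((s + g) - y * s) :=
    mul_le_mul_of_nonneg_right hm (by nlinarith)
  have t3 : 0 ≤ (1 + y) * (y * n) * (y * n - (s + g)) + (y * n) * ((s + g) - y * s) - (1 - y) * s * (s + g) := by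
    nlinarith [t1, t2, mul_nonneg hσ.le hg0]
  nlinarith [mul_nonneg (mul_nonneg h1y.le hg0) t3, key]

/-- **(TopL2) for real parameters.**  `0 < y < 1`, `y ≤ g ≤ 1`, `0 < s < n`; with `c⁺(ρ) = max 0 (1/max(ρ, y²+(1−y)ρ) − 1)`:
`min(1−g, s/(s+g))·c⁺(s/n) ≤ (1−g)·c⁺((s+g)/n) + g·max(c⁺((s+g)/n), (1−y)/y)`. [this work] -/
theorem relay_cap_top_core (y g s n : ℝ) (hy0 : 0 < y) (hy1 : y < 1) (hyg : y ≤ g) (hg1 : g ≤ 1) (hs : 0 < s) (hsn : s < n) :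
    min (1 - g) (s / (s + g)) * max 0 (1 / max (s / n) (y ^ 2 + (1 - y) * (s / n)) - 1)
      ≤ (1 - g) * max 0 (1 / max ((s + g) / n) (y ^ 2 + (1 - y) * ((s + g) / n)) - 1)
        + g * max (max 0 (1 / max ((s + g) / n) (y ^ 2 + (1 - y) * ((s + g) / n)) - 1)) ((1 - y) / y) := by
  have hg0 : 0 < g := lt_of_lt_of_le hy0 hyg
  have hn : 0 < n := lt_trans hs hsn
  have hσ : 0 < s + g := by linarith
  rcases le_or_gt y ((s + g) / n) with htop | hcheap
  · -- not cheap: the endpoint form of (B)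
    have h := relay_cap_core_top y g s n hy0 hy1 hyg hg1 hs hsn htop
    have hm : (1 - y) / y ≤ max (max 0 (1 / max ((s + g) / n) (y ^ 2 + (1 - y) * ((s + g) / n)) - 1)) ((1 - y) / y) :=
      le_max_right _ _
    nlinarith [mul_le_mul_of_nonneg_left hm hg0.le]
  · -- cheap: the unshifted copy alone
    have hc := relay_cap_cheap_core y g s n hy0 hy1 hg0.le hs hsn hcheap.le
    set P := 1 / max (s / n) (y ^ 2 + (1 - y) * (s / n)) - 1 with hP
    set Q := 1 / max ((s + g) / n) (y ^ 2 + (1 - y) * ((s + g) / n)) - 1 with hQ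
    have hθ : min (1 - g) (s / (s + g)) ≤ s / (s + g) := min_le_right _ _
    have hθ0 : 0 ≤ min (1 - g) (s / (s + g)) := le_min (by linarith) (div_nonneg hs.le hσ.le)
    -- `Q ≥ 0` in the cheap regime (the gate is `≤ y < 1`)
    have hQ0 : 0 ≤ Q := by
      have hρ : (s + g) / n ≤ y := hcheap.le
      have e1 : max ((s + g) / n) (y ^ 2 + (1 - y) * ((s + g) / n)) = y ^ 2 + (1 - y) * ((s + g) / n) :=
        max_eq_right (by nlinarith [mul_nonneg hy0.le (sub_nonneg.2 hρ)])
      have hlt : y ^ 2 + (1 - y) * ((s + g) / n) ≤ 1 := by nlinarith [div_nonneg hσ.le hn.le]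
      have hpos : 0 < y ^ 2 + (1 - y) * ((s + g) / n) := by
        have : 0 ≤ (1 - y) * ((s + g) / n) := mul_nonneg (by linarith) (div_nonneg hσ.le hn.le)
        nlinarith
      rw [hQ, e1, sub_nonneg]
      rw [le_div_iff₀ hpos]; linarith
    rcases le_or_gt 0 P with hP0 | hPneg
    · rw [max_eq_right hP0, max_eq_right hQ0]
      have h1 : min (1 - g) (s / (s + g)) * P ≤ s / (s + g) * P := mul_le_mul_of_nonneg_right hθ hP0
      have h2 : Q ≤ (1 - g) * Q + g * max Q ((1 - y) / y) := by
        nlinarith [mul_le_mul_of_nonneg_left (le_max_left Q ((1 - y) / y)) hg0.le]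
      linarith
    · rw [max_eq_left hPneg.le, mul_zero, max_eq_right hQ0]
      have : 0 ≤ max Q ((1 - y) / y) := le_trans hQ0 (le_max_left _ _)
      positivity

/-- **(TopL2) for `LawDec.pairGate`**: `0 < y < 1`, `y ≤ g ≤ 1`, a low `i` (`2i < T`) and a compatible atom `a` (`T < i + a`):
`min(1−g, s/(s+g))·c⁺_T(i,a) ≤ (1−g)·c⁺_{T+g}(i,a) + g·max(c⁺_{T+g}(i,a), (1−y)/y)`, `c⁺ = max 0 (1/pairGate − 1)`, `s = T − 2i`. [this work] -/
theorem relay_cap_top_pairGate (y T g : ℝ) (i a : ℕ) (hy0 : 0 < y) (hy1 : y < 1) (hyg : y ≤ g) (hg1 : g ≤ 1)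
    (hlow : 2 * (i : ℝ) < T) (hcomp : T < (i : ℝ) + a) :
    min (1 - g) ((T - 2 * (i : ℝ)) / (T - 2 * (i : ℝ) + g)) * max 0 (1 / pairGate y T i a - 1)
      ≤ (1 - g) * max 0 (1 / pairGate y (T + g) i a - 1)
        + g * max (max 0 (1 / pairGate y (T + g) i a - 1)) ((1 - y) / y) := by
  have hcore := relay_cap_top_core y g (T - 2 * (i : ℝ)) ((a : ℝ) - i) hy0 hy1 hyg hg1 (by linarith) (by linarith)
  unfold pairGate
  rw [show T + g - 2 * (i : ℝ) = T - 2 * (i : ℝ) + g by ring]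
  exact hcore

end LawDec

end Quant

end Summit.CriticalPhenomena.PercolationContinuityZ3.Theorems
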